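import Literature.NumberTheory.LFunctions.GaussianHeckeMollifier
import Literature.NumberTheory.LFunctions.RieszPerronShiftToZero
import Literature.NumberTheory.LFunctions.GaussianHeckeConvexity
import HarnessLib

/-!
# Zero detection for the Hecke `L`-functions `D_m = 4 L(·, λ^m)` of `ℚ(i)`: every zero is of
# class I or class II (Montgomery's method)

Topic `Literature/NumberTheory/LFunctions`.  Everything in this file is PROVED; no definitions, no named
facts.  For `m ≥ 1`, `1 ≤ X ≤ x`, `x ≥ 8`, and a zero `ρ = β + iγ` of `D_m` (`GaussianHecke.heckeL m`)
with `7/10 ≤ β ≤ 1`, write `a = detCoeff m X = c_m ⋆ μ_{m,X}` (`GaussianHeckeMollifier.lean`: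
`a(1) = 4`, `a(n) = 0` for `1 < n ≤ X`) and `M_X(s) = L(μ_{m,X}, s)` (the mollifier).  Then
(`GaussianHecke.zero_detect`) at least one of

* **class I:** `‖∑_{X < n ≤ x} a(n) n^{-ρ} (1 − n/x)³‖ ≥ 1`,
* **class II:** `9600 · x^{1/2 − β} ∫ ‖D_m(1/2 + i(γ + t))‖ ‖M_X(1/2 + i(γ + t))‖ (1 + |t|)⁻⁴ dt ≥ 1`

holds.  Proof: Perron's formula of order three for `f(n) = a(n) n^{-ρ}` on the line `Re u = 2 − β`,
shifted to `Re u = 1/2 − β` across the pole of the kernel at `u = 0` — whose residue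
`x³ D_m(ρ) M_X(ρ)` vanishes (`RieszPerron3.sum_mul_sub_cube_eq_integral_left`, with the polynomial
growth `‖D_m(s) M_X(s)‖ ≤ D · #{N(d) ≤ X} · (|γ| + 2m + 4 + |Im u|)²` on `1/2 ≤ Re s ≤ 2` from
`GaussianHecke.norm_heckeL_le_mul_sq'`); on the left side only `n = 1` and `n > X` survive, so
`4(x − 1)³ ≤ x³ ‖class-I sum‖ + (60000/2π) x^{3 − (β − 1/2)} · (class-II integral)`, and
`4 (7/8)³ > 2`.

## References

* H. L. Montgomery, *Topics in Multiplicative Number Theory*, LNM 227 (1971), Ch. 12, Thm. 12.1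
  (the zero-detection method). [Montgomery1971]
* E. C. Titchmarsh, *The Theory of the Riemann Zeta-Function*, 2nd ed. (1986), §9.16–9.18.
  [Titchmarsh1986]
-/

noncomputable section

open Finset LSeries UniqueFactorizationMonoid Complex MeasureTheory Real

namespace Literature.NumberTheory.LFunctions

namespace GaussianHecke

open GaussianInt GaussianTheta

open scoped Classical

/-! ### Shifting an `L`-series by `n^{-ρ}` -/

/-- `term (g · n^{-ρ}) s n = term g (ρ + s) n`. [folklore] -/
theorem term_mul_cpow_neg (g : ℕ → ℂ) (ρ s : ℂ) (n : ℕ) :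
    term (fun n ↦ g n * (n : ℂ) ^ (-ρ)) s n = term g (ρ + s) n := by
  rcases eq_or_ne n 0 with rfl | hn
  · simp [term_zero]
  · have hnC : (n : ℂ) ≠ 0 := Nat.cast_ne_zero.2 hn
    rw [term_of_ne_zero hn, term_of_ne_zero hn, cpow_add _ _ hnC, cpow_neg]
    field_simp

/-- `L(g · n^{-ρ}, s) = L(g, ρ + s)`. [folklore] -/
theorem LSeries_mul_cpow_neg (g : ℕ → ℂ) (ρ s : ℂ) :
    LSeries (fun n ↦ g n * (n : ℂ) ^ (-ρ)) s = LSeries g (ρ + s) := by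
  simp only [LSeries, term_mul_cpow_neg]

/-- Summability of the shifted series. [folklore] -/
theorem LSeriesSummable_mul_cpow_neg {g : ℕ → ℂ} {ρ s : ℂ} (h : LSeriesSummable g (ρ + s)) :
    LSeriesSummable (fun n ↦ g n * (n : ℂ) ^ (-ρ)) s := by
  unfold LSeriesSummable at h ⊢
  have e : term (fun n ↦ g n * (n : ℂ) ^ (-ρ)) s = term g (ρ + s) := funext (term_mul_cpow_neg g ρ s)
  rw [e]
  exact h

/-! ### The mollifier as an entire function of moderate size -/

/-- For `v ∈ ℤ[i]*`, `N(v)` as a natural number is nonzero. [folklore] -/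
theorem natAbs_norm_ne_zero_of_mem {v : _root_.GaussianInt} (hv : v ∈ firstQuadrant) : v.norm.natAbs ≠ 0 := by
  have h := norm_pos_of_mem_firstQuadrant hv
  omega

/-- The mollifier `M_X(s) = ∑_{N(d) ≤ X} μ(d) λ^m(d) N(d)^{-s}` is entire. [folklore] -/
theorem differentiable_LSeries_moebCoeff (m : ℕ) (X : ℝ) :
    Differentiable ℂ (fun s ↦ LSeries (moebCoeff m X) s) := by
  have h : (fun s ↦ LSeries (moebCoeff m X) s) = fun s ↦ ∑ d ∈ normLEStar X,
      (moebius d : ℂ) * angularChar m d * ((d.norm.natAbs : ℕ) : ℂ) ^ (-s) :=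
    funext fun s ↦ LSeries_moebCoeff_eq_sum m X s
  rw [h]
  refine Differentiable.fun_sum fun d hd ↦ ?_
  have hd0 : ((d.norm.natAbs : ℕ) : ℂ) ≠ 0 :=
    Nat.cast_ne_zero.2 (natAbs_norm_ne_zero_of_mem (mem_normLEStar.1 hd).2)
  exact (differentiable_const _).mul (differentiable_id.neg.const_cpow (Or.inl hd0))

/-- `‖M_X(s)‖ ≤ #{d ∈ ℤ[i]* : N(d) ≤ X}` for `Re s ≥ 0` (each term has modulus `N(d)^{-Re s} ≤ 1`).
[folklore] -/
theorem norm_LSeries_moebCoeff_le (m : ℕ) (X : ℝ) {s : ℂ} (hs : 0 ≤ s.re) :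
    ‖LSeries (moebCoeff m X) s‖ ≤ (normLEStar X).card := by
  rw [LSeries_moebCoeff_eq_sum]
  refine (norm_sum_le _ _).trans ?_
  have h1 : ∀ d ∈ normLEStar X, ‖(moebius d : ℂ) * angularChar m d * ((d.norm.natAbs : ℕ) : ℂ) ^ (-s)‖ ≤ 1 := by
    intro d hd
    have hd' := (mem_normLEStar.1 hd).2
    have hpos : 0 < d.norm.natAbs := Nat.pos_of_ne_zero (natAbs_norm_ne_zero_of_mem hd')
    rw [norm_mul, norm_mul, norm_angularChar (ne_zero_of_mem_fq hd'), mul_one, Complex.norm_intCast,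
      Complex.norm_natCast_cpow_of_pos hpos, neg_re]
    have hμ : |(moebius d : ℝ)| ≤ 1 := by exact_mod_cast abs_moebius_le_one d
    have hone : (1 : ℝ) ≤ (d.norm.natAbs : ℕ) := by exact_mod_cast hpos
    have hr : ((d.norm.natAbs : ℕ) : ℝ) ^ (-s.re) ≤ 1 :=
      Real.rpow_le_one_of_one_le_of_nonpos hone (by linarith)
    calc |(moebius d : ℝ)| * ((d.norm.natAbs : ℕ) : ℝ) ^ (-s.re) ≤ 1 * 1 :=
          mul_le_mul hμ hr (Real.rpow_nonneg (by positivity) _) zero_le_one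
      _ = 1 := one_mul 1
  calc ∑ d ∈ normLEStar X, ‖(moebius d : ℂ) * angularChar m d * ((d.norm.natAbs : ℕ) : ℂ) ^ (-s)‖
      ≤ ∑ d ∈ normLEStar X, (1 : ℝ) := sum_le_sum h1
    _ = (normLEStar X).card := by simp

/-! ### Zero detection -/

/-- `4 (7/8)³ > 2`, in the form used below: for `x ≥ 8`, `2 ≤ 4 (1 − 1/x)³`. [folklore] -/
theorem two_le_four_mul_cube {x : ℝ} (hx : 8 ≤ x) : 2 ≤ 4 * (1 - 1 / x) ^ 3 := by
  have h1 : 7 / 8 ≤ 1 - 1 / x := by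
    rw [div_le_iff₀ (by linarith)] at *
    · have : 1 / x ≤ 1 / 8 := one_div_le_one_div_of_le (by norm_num) hx
      linarith
  have h2 : (7 / 8 : ℝ) ^ 3 ≤ (1 - 1 / x) ^ 3 := pow_le_pow_left₀ (by norm_num) h1 3
  nlinarith

set_option maxHeartbeats 800000 in
/-- **Zero detection (class I / class II).**  Let `m ≥ 1`, `1 ≤ X ≤ x`, `x ≥ 8`, and let `ρ = β + iγ` be
a zero of `D_m` with `7/10 ≤ β ≤ 1`.  Then either
`‖∑_{X < n ≤ x} detCoeff(n) n^{-ρ} (1 − n/x)³‖ ≥ 1` (class I) or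
`9600 x^{1/2−β} ∫ ‖D_m(1/2 + i(γ+t))‖ ‖M_X(1/2 + i(γ+t))‖ (1 + |t|)⁻⁴ dt ≥ 1` (class II).
[cite: Montgomery1971, Ch. 12, Thm. 12.1] -/
theorem zero_detect {m : ℕ} (hm : m ≠ 0) {X x : ℝ} (hX : 1 ≤ X) (hXx : X ≤ x) (hx8 : 8 ≤ x)
    {ρ : ℂ} (hρ : heckeL m ρ = 0) (hβ : 7 / 10 ≤ ρ.re) (hβ1 : ρ.re ≤ 1) :
    1 ≤ ‖∑ n ∈ Ioc ⌊X⌋₊ ⌊x⌋₊, detCoeff m X n * (n : ℂ) ^ (-ρ) * (1 - (n : ℂ) / x) ^ 3‖ ∨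
    1 ≤ 9600 * x ^ (1 / 2 - ρ.re) * ∫ t : ℝ, ‖heckeL m (1 / 2 + (ρ.im + t) * I)‖ *
        ‖LSeries (moebCoeff m X) (1 / 2 + (ρ.im + t) * I)‖ * ((1 + |t|) ^ 4)⁻¹ := by
  -- parameters
  set β : ℝ := ρ.re with hβdef
  set γ : ℝ := ρ.im with hγdef
  set η : ℝ := β - 1 / 2 with hηdef
  set c : ℝ := 2 - β with hcdef
  have hη1 : 1 / 5 ≤ η := by rw [hηdef]; linarith
  have hη2 : η ≤ 1 / 2 := by rw [hηdef]; linarith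
  have hc0 : 0 < c := by rw [hcdef]; linarith
  have hx1 : 1 ≤ x := by linarith
  have hx0 : 0 < x := by linarith
  have hρeq : ρ = (β : ℂ) + γ * I := (re_add_im ρ).symm
  -- the entire function `Φ(u) = D_m(ρ + u) M_X(ρ + u)`
  set M : ℂ → ℂ := fun s ↦ LSeries (moebCoeff m X) s with hMdef
  set Φ : ℂ → ℂ := fun u ↦ heckeL m (ρ + u) * M (ρ + u) with hΦdef
  have hMd : Differentiable ℂ M := differentiable_LSeries_moebCoeff m X
  have hΦd : Differentiable ℂ Φ := by
    have h1 : Differentiable ℂ fun u : ℂ ↦ ρ + u := (differentiable_const ρ).add differentiable_id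
    exact ((differentiable_heckeL hm).comp h1).mul (hMd.comp h1)
  have hΦ0 : Φ 0 = 0 := by simp [hΦdef, hρ]
  -- growth of `Φ` on `1/2 - β ≤ Re u ≤ 2 - β`
  obtain ⟨D, hD0, hDbound, -⟩ := exists_norm_heckeL_le_mul_sq
  obtain ⟨N₀, hN₀def⟩ : ∃ N₀ : ℝ, N₀ = ((normLEStar X).card : ℝ) := ⟨_, rfl⟩
  obtain ⟨A, hAdef⟩ : ∃ A : ℝ, A = D * (N₀ + 1) := ⟨_, rfl⟩
  obtain ⟨K₁, hK₁def⟩ : ∃ K₁ : ℝ, K₁ = |γ| + 2 * m + 4 := ⟨_, rfl⟩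
  have hN0 : (0 : ℝ) ≤ N₀ := by rw [hN₀def]; exact Nat.cast_nonneg _
  have hA0 : 0 ≤ A := by rw [hAdef]; exact mul_nonneg hD0.le (by linarith)
  have hm0 : (0 : ℝ) ≤ m := Nat.cast_nonneg m
  have hK₁1 : 1 ≤ K₁ := by rw [hK₁def]; have := abs_nonneg γ; linarith
  have hbound : ∀ u : ℂ, -η ≤ u.re → u.re ≤ c → ‖Φ u‖ ≤ A * (K₁ + |u.im|) ^ 2 := by
    intro u hu1 hu2
    have hre1 : 1 / 2 ≤ (ρ + u).re := by rw [add_re, ← hβdef]; rw [hηdef] at hu1; linarith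
    have hre2 : (ρ + u).re ≤ 2 := by rw [add_re, ← hβdef]; rw [hcdef] at hu2; linarith
    have hL : ‖heckeL m (ρ + u)‖ ≤ D * (|(ρ + u).im| + 2 * m + 4) ^ 2 := by
      have h := norm_heckeL_le_mul_sq' hm (z := ρ + u) (by linarith) (by linarith)
      refine (hDbound m hm (ρ + u) (by linarith)).trans ?_
      -- `hDbound` is stated with `‖z + 2m + 1‖²`; convert through the `|Im| + 2m + 4` form
      have h2 : ‖ρ + u + 2 * m + 1‖ ≤ |(ρ + u).im| + 2 * m + 4 := by
        refine (Complex.norm_le_abs_re_add_abs_im _).trans ?_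
        have hre : |(ρ + u + 2 * m + 1).re| ≤ 2 * m + 4 := by
          simp only [add_re, mul_re, re_ofNat, natCast_re, im_ofNat, natCast_im, mul_zero, sub_zero,
            one_re]
          rw [abs_le]
          have hm0 : (0 : ℝ) ≤ m := Nat.cast_nonneg m
          have hr1 : 1 / 2 ≤ ρ.re + u.re := by rw [add_re] at hre1; exact hre1
          have hr2 : ρ.re + u.re ≤ 2 := by rw [add_re] at hre2; exact hre2
          constructor <;> nlinarith
        have him : |(ρ + u + 2 * m + 1).im| = |(ρ + u).im| := by simp
        rw [him]; linarith
      exact mul_le_mul_of_nonneg_left (pow_le_pow_left₀ (norm_nonneg _) h2 2) hD0.le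
    have hMle : ‖M (ρ + u)‖ ≤ N₀ := by
      rw [hN₀def]; exact norm_LSeries_moebCoeff_le m X (by linarith)
    have him : |(ρ + u).im| ≤ |γ| + |u.im| := by rw [add_im, ← hγdef]; exact abs_add_le _ _
    calc ‖Φ u‖ = ‖heckeL m (ρ + u)‖ * ‖M (ρ + u)‖ := norm_mul _ _
      _ ≤ D * (|(ρ + u).im| + 2 * m + 4) ^ 2 * N₀ :=
          mul_le_mul hL hMle (norm_nonneg _) (by positivity)
      _ ≤ D * (K₁ + |u.im|) ^ 2 * (N₀ + 1) := by
          have h1 : (|(ρ + u).im| + 2 * m + 4) ^ 2 ≤ (K₁ + |u.im|) ^ 2 := by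
            apply pow_le_pow_left₀ (by positivity)
            rw [hK₁def]; linarith
          calc D * (|(ρ + u).im| + 2 * m + 4) ^ 2 * N₀ ≤ D * (K₁ + |u.im|) ^ 2 * N₀ := by gcongr
            _ ≤ D * (K₁ + |u.im|) ^ 2 * (N₀ + 1) := by gcongr; linarith
      _ = A * (K₁ + |u.im|) ^ 2 := by rw [hAdef]; ring
  -- the Dirichlet series `f(n) = a(n) n^{-ρ}` on `Re u = c`
  set f : ℕ → ℂ := fun n ↦ detCoeff m X n * (n : ℂ) ^ (-ρ) with hfdef
  have hρc : 1 < (ρ + c).re := by simp [hcdef, ← hβdef]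
  have hsum : LSeriesSummable f c := LSeriesSummable_mul_cpow_neg (LSeriesSummable_detCoeff m X hρc)
  have hLf : ∀ t : ℝ, LSeries f (c + t * I) = Φ (c + t * I) := by
    intro t
    have hre : 1 < (ρ + (c + t * I)).re := by simp [hcdef, ← hβdef]
    rw [hfdef, LSeries_mul_cpow_neg, hΦdef, hMdef]
    exact (heckeL_mul_LSeries_moebCoeff m X hre).symm
  -- Perron on the left line and the size of the shifted integral
  have hE := RieszPerron3.sum_mul_sub_cube_eq_integral_left f hΦd hΦ0 hc0 hη1 hη2 hx1 hA0 hK₁1 hbound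
    hsum hLf
  have hΦl : ∀ t : ℝ, ‖Φ (((-η : ℝ) : ℂ) + t * I)‖ ≤ A * (K₁ + |t|) ^ 2 := fun t ↦ by
    have := hbound (((-η : ℝ) : ℂ) + t * I) (by simp) (by simp; linarith)
    simpa using this
  have hI := RieszPerron3.norm_integral_left_le hΦd.continuous hη1 hη2 hx1 hA0 hK₁1 hΦl
  -- the left side: only `n = 1` and `n > X` contribute
  have hX1 : 1 ≤ ⌊X⌋₊ := Nat.le_floor (by exact_mod_cast hX)
  have hXx' : ⌊X⌋₊ ≤ ⌊x⌋₊ := Nat.floor_le_floor hXx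
  have hsplit : ∑ n ∈ Ioc 0 ⌊x⌋₊, f n * ((x : ℂ) - n) ^ 3 =
      4 * ((x : ℂ) - 1) ^ 3 + ∑ n ∈ Ioc ⌊X⌋₊ ⌊x⌋₊, f n * ((x : ℂ) - n) ^ 3 := by
    rw [← sum_Ioc_consecutive _ (Nat.zero_le 1) (hX1.trans hXx'), ← sum_Ioc_consecutive _ hX1 hXx']
    have h1 : ∑ n ∈ Ioc 0 1, f n * ((x : ℂ) - n) ^ 3 = 4 * ((x : ℂ) - 1) ^ 3 := by
      rw [show Ioc 0 1 = {1} by rfl, sum_singleton, hfdef]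
      simp [detCoeff_one m hX]
    have h2 : ∑ n ∈ Ioc 1 ⌊X⌋₊, f n * ((x : ℂ) - n) ^ 3 = 0 := by
      refine sum_eq_zero fun n hn ↦ ?_
      rw [mem_Ioc] at hn
      have hnX : (n : ℝ) ≤ X := le_trans (by exact_mod_cast hn.2) (Nat.floor_le (by linarith))
      rw [hfdef]
      simp [detCoeff_eq_zero m hn.1 hnX]
    rw [h1, h2, zero_add]
  -- factor `x³` out of the class-I sum
  have hfactor : ∑ n ∈ Ioc ⌊X⌋₊ ⌊x⌋₊, f n * ((x : ℂ) - n) ^ 3 =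
      (x : ℂ) ^ 3 * ∑ n ∈ Ioc ⌊X⌋₊ ⌊x⌋₊, detCoeff m X n * (n : ℂ) ^ (-ρ) * (1 - (n : ℂ) / x) ^ 3 := by
    rw [mul_sum]
    refine sum_congr rfl fun n _ ↦ ?_
    have hxC : (x : ℂ) ≠ 0 := ofReal_ne_zero.2 hx0.ne'
    have e : ((x : ℂ) - n) ^ 3 = (x : ℂ) ^ 3 * (1 - (n : ℂ) / x) ^ 3 := by
      rw [← mul_pow, mul_sub, mul_one, mul_div_cancel₀ _ hxC]
    rw [hfdef, e]
    ring
  -- `Φ` on the left line is `D_m M_X` on `Re s = 1/2`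
  have hΦleft : ∀ t : ℝ, Φ (((-η : ℝ) : ℂ) + t * I) =
      heckeL m (1 / 2 + (γ + t) * I) * M (1 / 2 + (γ + t) * I) := by
    intro t
    have hs : ρ + (((-η : ℝ) : ℂ) + t * I) = 1 / 2 + (γ + t) * I := by
      rw [hρeq, hηdef]; push_cast; ring
    simp only [hΦdef, hs]
  -- assemble the inequality `4(x-1)³ ≤ x³ S + (60000/2π) x^{3-η} J`
  set S : ℝ := ‖∑ n ∈ Ioc ⌊X⌋₊ ⌊x⌋₊, detCoeff m X n * (n : ℂ) ^ (-ρ) * (1 - (n : ℂ) / x) ^ 3‖ with hSdef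
  set J : ℝ := ∫ t : ℝ, ‖heckeL m (1 / 2 + (γ + t) * I)‖ * ‖M (1 / 2 + (γ + t) * I)‖ * ((1 + |t|) ^ 4)⁻¹
    with hJdef
  have hJeq : (∫ t : ℝ, ‖Φ (((-η : ℝ) : ℂ) + t * I)‖ * ((1 + |t|) ^ 4)⁻¹) = J := by
    rw [hJdef]
    refine integral_congr_ae (Filter.Eventually.of_forall fun t ↦ ?_)
    simp only [hΦleft t, norm_mul]
  have hS0 : 0 ≤ S := norm_nonneg _
  have hJ0 : 0 ≤ J := by
    rw [hJdef]; exact integral_nonneg fun t ↦ by positivity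
  have hπ : (3.14 : ℝ) < π := Real.pi_gt_d2
  have hmain : 4 * (x - 1) ^ 3 ≤ x ^ 3 * S + 1 / (2 * π) * (60000 * x ^ (3 - η) * J) := by
    have h1 : ‖(4 : ℂ) * ((x : ℂ) - 1) ^ 3‖ = 4 * (x - 1) ^ 3 := by
      rw [show (4 : ℂ) * ((x : ℂ) - 1) ^ 3 = (((4 * (x - 1) ^ 3 : ℝ)) : ℂ) by push_cast; ring,
        Complex.norm_real, Real.norm_of_nonneg
          (mul_nonneg (by norm_num) (pow_nonneg (by linarith : (0 : ℝ) ≤ x - 1) 3))]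
    have hkey : (4 : ℂ) * ((x : ℂ) - 1) ^ 3 = -((x : ℂ) ^ 3 * ∑ n ∈ Ioc ⌊X⌋₊ ⌊x⌋₊,
        detCoeff m X n * (n : ℂ) ^ (-ρ) * (1 - (n : ℂ) / x) ^ 3) + (1 / (2 * π) : ℂ) *
        ∫ t : ℝ, (x : ℂ) ^ (3 + (((-η : ℝ) : ℂ) + t * I)) * Φ (((-η : ℝ) : ℂ) + t * I) *
          (6 / ((((-η : ℝ) : ℂ) + t * I) * (((-η : ℝ) : ℂ) + t * I + 1) * (((-η : ℝ) : ℂ) + t * I + 2) *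
            (((-η : ℝ) : ℂ) + t * I + 3))) := by
      rw [← hfactor]
      have := hE
      rw [hsplit] at this
      linear_combination this
    have hx3 : ‖(x : ℂ) ^ 3‖ = x ^ 3 := by
      rw [norm_pow, Complex.norm_real, Real.norm_of_nonneg hx0.le]
    have hπn : ‖(1 / (2 * π) : ℂ)‖ = 1 / (2 * π) := by
      rw [show (1 / (2 * π) : ℂ) = ((1 / (2 * π) : ℝ) : ℂ) by push_cast; ring, Complex.norm_real,
        Real.norm_of_nonneg (by positivity)]
    calc 4 * (x - 1) ^ 3 = ‖(4 : ℂ) * ((x : ℂ) - 1) ^ 3‖ := h1.symm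
      _ ≤ ‖-((x : ℂ) ^ 3 * ∑ n ∈ Ioc ⌊X⌋₊ ⌊x⌋₊,
            detCoeff m X n * (n : ℂ) ^ (-ρ) * (1 - (n : ℂ) / x) ^ 3)‖ + ‖(1 / (2 * π) : ℂ) *
            ∫ t : ℝ, (x : ℂ) ^ (3 + (((-η : ℝ) : ℂ) + t * I)) * Φ (((-η : ℝ) : ℂ) + t * I) *
              (6 / ((((-η : ℝ) : ℂ) + t * I) * (((-η : ℝ) : ℂ) + t * I + 1) *
                (((-η : ℝ) : ℂ) + t * I + 2) * (((-η : ℝ) : ℂ) + t * I + 3)))‖ := by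
          rw [hkey]; exact norm_add_le _ _
      _ ≤ x ^ 3 * S + 1 / (2 * π) * (60000 * x ^ (3 - η) * J) := by
          rw [norm_neg, norm_mul, hx3, ← hSdef, norm_mul, hπn, ← hJeq]
          gcongr
  -- divide by `x³`: `2 ≤ 4(1-1/x)³ ≤ S + 9600 x^{-η} J`
  have hx3pos : 0 < x ^ 3 := by positivity
  have hdiv : 4 * (1 - 1 / x) ^ 3 ≤ S + 9600 * x ^ (1 / 2 - β) * J := by
    have e1 : 4 * (1 - 1 / x) ^ 3 = (4 * (x - 1) ^ 3) / x ^ 3 := by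
      field_simp
    have e2 : x ^ (3 - η) = x ^ 3 * x ^ (1 / 2 - β) := by
      rw [show (3 : ℝ) - η = 3 + (1 / 2 - β) by rw [hηdef]; ring, Real.rpow_add hx0,
        show (3 : ℝ) = ((3 : ℕ) : ℝ) by norm_num, Real.rpow_natCast]
    rw [e1, div_le_iff₀ hx3pos]
    refine hmain.trans ?_
    rw [e2]
    have hcoef : 1 / (2 * π) * 60000 ≤ 9600 := by
      rw [div_mul_eq_mul_div, div_le_iff₀ (by positivity)]; nlinarith
    have hxp : 0 ≤ x ^ (1 / 2 - β) := Real.rpow_nonneg hx0.le _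
    have : 1 / (2 * π) * (60000 * (x ^ 3 * x ^ (1 / 2 - β)) * J) ≤ 9600 * x ^ (1 / 2 - β) * J * x ^ 3 := by
      have h0 : 0 ≤ x ^ 3 * x ^ (1 / 2 - β) * J := by positivity
      nlinarith
    nlinarith
  have h2 := two_le_four_mul_cube hx8
  -- conclude
  by_contra hcon
  rw [not_or, not_le, not_le] at hcon
  have : S + 9600 * x ^ (1 / 2 - β) * J < 2 := by linarith [hcon.1, hcon.2]
  linarith

end GaussianHecke

end Literature.NumberTheory.LFunctions
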